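import Literature.NumberTheory.Transcendental.RoySmallValueEstimatesClosestPointProofs
import Mathlib.Analysis.Convex.SpecificFunctions.Basic
import Mathlib.Analysis.SpecialFunctions.Pow.Real
import Mathlib.Algebra.BigOperators.Intervals
import HarnessLib

/-!
# Real-analysis lemmas for stub `stub_sharpClosestPoint` (line `orbit-interpolation-determinant`, crux `ApproximationProperty`, stmt-Schanuel-6117)

Helper file (proofs only, no definitions) of the stub
`stub_sharpClosestPoint : OrbitClusterBound → ZeroDimDictionary → SharpClosestPoint` of the checked
skeleton `Cruxes/ApproximationProperty/Lines/orbit-interpolation-determinant.lean`, proved in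
`DiophantineDichotomyApproximationPropertySharpClosestPoint.lean` (which imports this file):

* (from the tree: `NguyenRoy.projDist_le_two` — Nesterenko's projective distance is `≤ 2`);
* `sharp_mul_rpow_neg_le_sub`, `sharp_sum_Ico_rpow_le_sub`, `sharp_sum_Ico_rpow_le` — the tail sum
  `Σ_{k>ℓ} k^{-1-1/m} ≤ m ℓ^{-1/m}` (Bernoulli's inequality for exponents in `[0, 1]` + telescoping);
* `sharp_pow_le_prod_mul_exp` — the extraction of the closest conjugate: if the sorted distances
  `ρ₀ ≤ … ≤ ρ_{D-1} ∈ [0, 2]` satisfy `log (1/ρ_i) ≤ A + B (i+1)^{-1-1/m}` for `i ≥ ℓ`, then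
  `ρ₀^ℓ ≤ (∏ ρ_i) exp(ℓ log 2 + D A + B m/ℓ^{1/m})`;
* `sharp_exponent_le` — bookkeeping of the final exponent;
* `stub_sharpClosestPoint_lemmas` — the registered sub-goal of this helper file.

Sources: NesterenkoPhilippon2001 (LNM 1752) Ch. 3 §4; folklore real analysis.
-/

noncomputable section

-- `Summit.Schanuel.Schanuel.…` is the mandated summit/sub-problem namespace (single-conjunct summit), hence:
set_option linter.dupNamespace false

namespace Summit.Schanuel.Schanuel.Cruxes.ApproximationProperty.OrbitInterpolationDeterminant

open Literature.NumberTheory.Transcendental.Nesterenko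
open Literature.NumberTheory.Transcendental.PhilipponMain
open scoped BigOperators

/-! ### Elementary lemmas -/

/-- A conjugate of a non-zero vector of a field is non-zero. [folklore] -/
theorem sharp_conj_ne_zero {K : Type} [Field K] {n : ℕ} (σ : K →+* ℂ) {b : Fin n → K} (hb : b ≠ 0) :
    (fun j => σ (b j)) ≠ 0 := by
  obtain ⟨j, hj⟩ := Function.ne_iff.mp hb
  exact Function.ne_iff.mpr ⟨j, by simpa using (map_ne_zero σ).mpr hj⟩

/-- `|ω̄| ≤ 2 + ‖ω‖` for `ω̄ = (1 : ω)`. [folklore] -/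
theorem sharp_norm_cons_one_le {m : ℕ} (ω : Fin m → ℂ) :
    ‖(Fin.cons 1 ω : Fin (m + 1) → ℂ)‖ ≤ 2 + ‖ω‖ := by
  refine (pi_norm_le_iff_of_nonneg (by positivity)).mpr fun i => ?_
  refine Fin.cases ?_ (fun j => ?_) i
  · have := norm_nonneg ω
    simp only [Fin.cons_zero, norm_one]
    linarith
  · rw [cons_one_succ]
    linarith [norm_le_pi_norm ω j, norm_nonneg ω]

/-! ### The tail sum `Σ_{k > ℓ} k^{-1-1/m} ≤ m ℓ^{-1/m}` -/

/-- Bernoulli step: for `0 < a ≤ 1` and `1 ≤ x`, `a (x+1)^{-(1+a)} ≤ x^{-a} − (x+1)^{-a}`.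
[folklore] -/
theorem sharp_mul_rpow_neg_le_sub {a x : ℝ} (ha : 0 < a) (ha1 : a ≤ 1) (hx : 1 ≤ x) :
    a * (x + 1) ^ (-(1 + a)) ≤ x ^ (-a) - (x + 1) ^ (-a) := by
  have hx1 : 0 < x + 1 := by linarith
  set y : ℝ := 1 / (x + 1) with hy
  have hy0 : 0 < y := by positivity
  have hy1 : y ≤ 1 / 2 := by
    rw [hy, div_le_div_iff₀ hx1 two_pos]; linarith
  have h1y : 0 < 1 + -y := by linarith
  have hxs : (x + 1) * (1 + -y) = x := by
    rw [hy]; field_simp; ring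
  set u : ℝ := (x + 1) ^ (-a) with hu
  have hu0 : 0 < u := Real.rpow_pos_of_pos hx1 _
  have e1 : (x + 1) ^ (-(1 + a)) = u * y := by
    rw [show -(1 + a) = -a - 1 by ring, Real.rpow_sub_one hx1.ne', hy]; ring
  have hbern : (1 + -y) ^ a ≤ 1 + a * -y :=
    rpow_one_add_le_one_add_mul_self (by linarith) ha.le ha1
  have hpow_pos : 0 < (1 + -y) ^ a := Real.rpow_pos_of_pos h1y _
  have hkey : 1 + a * y ≤ ((1 + -y) ^ a)⁻¹ := by
    rw [le_inv_comm₀ (by positivity) hpow_pos]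
    calc (1 + -y) ^ a ≤ 1 + a * -y := hbern
      _ ≤ (1 + a * y)⁻¹ := by
          rw [inv_eq_one_div, le_div_iff₀ (by positivity)]
          nlinarith [sq_nonneg (a * y)]
  have hx_eq : x ^ (-a) = u * ((1 + -y) ^ a)⁻¹ := by
    rw [← Real.rpow_neg h1y.le, hu, ← Real.mul_rpow hx1.le h1y.le, hxs]
  have h := mul_le_mul_of_nonneg_left hkey hu0.le
  have e : u * (1 + a * y) = u + a * (u * y) := by ring
  rw [e1, hx_eq]
  rw [e] at h
  linarith

/-- Telescoped tail: `Σ_{k ∈ [ℓ, N)} (k+1)^{-(1+1/m)} ≤ m (ℓ^{-1/m} − N^{-1/m})` for `1 ≤ ℓ ≤ N`,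
`1 ≤ m`. [folklore] -/
theorem sharp_sum_Ico_rpow_le_sub {m ℓ : ℕ} (hm : 1 ≤ m) (hℓ : 1 ≤ ℓ) (N : ℕ) (hN : ℓ ≤ N) :
    ∑ k ∈ Finset.Ico ℓ N, ((k : ℝ) + 1) ^ (-(1 + 1 / (m : ℝ))) ≤
      m * ((ℓ : ℝ) ^ (-(1 / (m : ℝ))) - (N : ℝ) ^ (-(1 / (m : ℝ)))) := by
  induction N, hN using Nat.le_induction with
  | base => simp
  | succ N hN ih =>
    rw [Finset.sum_Ico_succ_top hN]
    have hm0 : (0 : ℝ) < m := by exact_mod_cast hm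
    have hstep := sharp_mul_rpow_neg_le_sub (a := 1 / (m : ℝ)) (x := (N : ℝ)) (by positivity)
      (by rw [div_le_one hm0]; exact_mod_cast hm) (by exact_mod_cast hℓ.trans hN)
    have e : (m : ℝ) * (1 / (m : ℝ)) = 1 := by field_simp
    have key : ((N : ℝ) + 1) ^ (-(1 + 1 / (m : ℝ))) ≤
        m * ((N : ℝ) ^ (-(1 / (m : ℝ))) - ((N : ℝ) + 1) ^ (-(1 / (m : ℝ)))) := by
      calc ((N : ℝ) + 1) ^ (-(1 + 1 / (m : ℝ)))
          = m * ((1 / (m : ℝ)) * ((N : ℝ) + 1) ^ (-(1 + 1 / (m : ℝ)))) := by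
            rw [← mul_assoc, e, one_mul]
        _ ≤ m * ((N : ℝ) ^ (-(1 / (m : ℝ))) - ((N : ℝ) + 1) ^ (-(1 / (m : ℝ)))) :=
            mul_le_mul_of_nonneg_left hstep hm0.le
    push_cast
    linarith

/-- The tail bound used in the extraction: `Σ_{k ∈ [ℓ, N)} (k+1)^{-(1+1/m)} ≤ m / ℓ^{1/m}` for
`1 ≤ ℓ`, `1 ≤ m` (any `N`). [folklore] -/
theorem sharp_sum_Ico_rpow_le {m ℓ : ℕ} (hm : 1 ≤ m) (hℓ : 1 ≤ ℓ) (N : ℕ) :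
    ∑ k ∈ Finset.Ico ℓ N, ((k : ℝ) + 1) ^ (-(1 + 1 / (m : ℝ))) ≤
      m / (ℓ : ℝ) ^ (1 / (m : ℝ)) := by
  have hm0 : (0 : ℝ) < m := by exact_mod_cast hm
  have hdiv : (m : ℝ) / (ℓ : ℝ) ^ (1 / (m : ℝ)) = m * (ℓ : ℝ) ^ (-(1 / (m : ℝ))) := by
    rw [Real.rpow_neg (by positivity), div_eq_mul_inv]
  rw [hdiv]
  rcases le_or_gt ℓ N with hN | hN
  · refine (sharp_sum_Ico_rpow_le_sub hm hℓ N hN).trans ?_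
    have : 0 ≤ (N : ℝ) ^ (-(1 / (m : ℝ))) := Real.rpow_nonneg (by positivity) _
    nlinarith
  · rw [Finset.Ico_eq_empty (by omega), Finset.sum_empty]
    exact mul_nonneg hm0.le (Real.rpow_nonneg (by positivity) _)


/-! ### The extraction of the closest conjugate (pure real analysis) -/

/-- **Extraction.** If `ρ₀ ≤ ρ₁ ≤ … ≤ ρ_{D−1}` lie in `[0, 2]` and
`log (1/ρ_i) ≤ A + B (i+1)^{-(1+1/m)}` whenever `i ≥ ℓ` and `ρ_i > 0`, then
`ρ₀^ℓ ≤ (∏ ρ_i) · exp(ℓ log 2 + D A + B m / ℓ^{1/m})` (for `ℓ ≥ D` by `ρ₀^D ≤ ∏ ρ_i` and `ρ₀ ≤ 2`;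
for `ℓ < D` by `ρ₀^ℓ ≤ ∏_{i<ℓ} ρ_i` and the tail sum). [folklore] -/
theorem sharp_pow_le_prod_mul_exp {D ℓ m : ℕ} (hm : 1 ≤ m) (hℓ : 1 ≤ ℓ) (hD : 0 < D) (ρ : Fin D → ℝ)
    (hmono : Monotone ρ) (h0 : ∀ i, 0 ≤ ρ i) (h2 : ∀ i, ρ i ≤ 2) {A B : ℝ} (hA : 0 ≤ A)
    (hB : 0 ≤ B)
    (hbound : ∀ i : Fin D, ℓ ≤ (i : ℕ) → 0 < ρ i →
      Real.log (1 / ρ i) ≤ A + B * ((i : ℝ) + 1) ^ (-(1 + 1 / (m : ℝ)))) :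
    ρ ⟨0, hD⟩ ^ ℓ ≤
      (∏ i, ρ i) * Real.exp (ℓ * Real.log 2 + D * A + B * (m / (ℓ : ℝ) ^ (1 / (m : ℝ)))) := by
  have hlog2 : 0 < Real.log 2 := Real.log_pos one_lt_two
  set ρ₀ : ℝ := ρ ⟨0, hD⟩ with hρ₀
  have hρ₀0 : 0 ≤ ρ₀ := h0 _
  have hρ₀le : ∀ i, ρ₀ ≤ ρ i := fun i => hmono (show (⟨0, hD⟩ : Fin D) ≤ i from Nat.zero_le _)
  have hprod0 : 0 ≤ ∏ i, ρ i := Finset.prod_nonneg fun i _ => h0 i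
  have hmℓ : 0 ≤ (m : ℝ) / (ℓ : ℝ) ^ (1 / (m : ℝ)) := by positivity
  set X : ℝ := ℓ * Real.log 2 + D * A + B * (m / (ℓ : ℝ) ^ (1 / (m : ℝ))) with hX
  have hXge : ℓ * Real.log 2 ≤ X := by
    have : 0 ≤ (D : ℝ) * A := by positivity
    have : 0 ≤ B * (m / (ℓ : ℝ) ^ (1 / (m : ℝ))) := by positivity
    rw [hX]; linarith
  have h2ℓ : (2 : ℝ) ^ ℓ ≤ Real.exp X := by
    have e : (2 : ℝ) ^ ℓ = Real.exp (ℓ * Real.log 2) := by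
      rw [Real.exp_nat_mul, Real.exp_log two_pos]
    rw [e, Real.exp_le_exp]
    exact hXge
  by_cases hDℓ : D ≤ ℓ
  · -- every conjugate is used: `ρ₀^D ≤ ∏ ρ_i`, `ρ₀^{ℓ-D} ≤ 2^ℓ`
    have h1 : ρ₀ ^ D ≤ ∏ i, ρ i := by
      calc ρ₀ ^ D = ∏ _i : Fin D, ρ₀ := by simp
        _ ≤ ∏ i, ρ i := Finset.prod_le_prod (fun i _ => hρ₀0) (fun i _ => hρ₀le i)
    calc ρ₀ ^ ℓ = ρ₀ ^ D * ρ₀ ^ (ℓ - D) := by rw [← pow_add, Nat.add_sub_cancel' hDℓ]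
      _ ≤ (∏ i, ρ i) * 2 ^ ℓ := by
          refine mul_le_mul h1 ?_ (by positivity) hprod0
          exact (pow_le_pow_left₀ hρ₀0 (h2 _) _).trans
            (pow_le_pow_right₀ one_le_two (Nat.sub_le ℓ D))
      _ ≤ (∏ i, ρ i) * Real.exp X := mul_le_mul_of_nonneg_left h2ℓ hprod0
  · push Not at hDℓ
    -- pass to `ℕ`-indexed products
    set g : ℕ → ℝ := fun n => if h : n < D then ρ ⟨n, h⟩ else 1 with hg
    have hgρ : ∀ i : Fin D, g i = ρ i := fun i => by simp [hg, i.2]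
    have hg0 : ∀ n, 0 ≤ g n := fun n => by
      simp only [hg]
      split_ifs
      · exact h0 _
      · exact zero_le_one
    have hρ₀g : ∀ n, n < D → ρ₀ ≤ g n := fun n hn => by
      simp only [hg, dif_pos hn]; exact hρ₀le _
    have hprod : ∏ i, ρ i = ∏ n ∈ Finset.range D, g n := by
      rw [← Fin.prod_univ_eq_prod_range]
      exact Finset.prod_congr rfl fun i _ => (hgρ i).symm
    have hsplit := Finset.prod_range_mul_prod_Ico g hDℓ.le
    have h1 : ρ₀ ^ ℓ ≤ ∏ n ∈ Finset.range ℓ, g n := by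
      calc ρ₀ ^ ℓ = ∏ _n ∈ Finset.range ℓ, ρ₀ := by simp
        _ ≤ _ := Finset.prod_le_prod (fun _ _ => hρ₀0) fun n hn =>
            hρ₀g n ((Finset.mem_range.mp hn).trans hDℓ)
    by_cases hzero : ∃ n ∈ Finset.Ico ℓ D, g n = 0
    · obtain ⟨n, hn, hn0⟩ := hzero
      have hnD : n < D := (Finset.mem_Ico.mp hn).2
      have hρ₀z : ρ₀ = 0 := le_antisymm (hn0 ▸ hρ₀g n hnD) hρ₀0
      rw [hρ₀z, zero_pow (by omega)]
      exact mul_nonneg hprod0 (Real.exp_nonneg _)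
    · push Not at hzero
      have hgpos : ∀ n ∈ Finset.Ico ℓ D, 0 < g n := fun n hn =>
        lt_of_le_of_ne (hg0 n) (hzero n hn).symm
      set P : ℝ := ∏ n ∈ Finset.Ico ℓ D, g n with hP
      have hP0 : 0 < P := Finset.prod_pos hgpos
      have hlog : Real.log (1 / P) ≤ D * A + B * (m / (ℓ : ℝ) ^ (1 / (m : ℝ))) := by
        have e : Real.log (1 / P) = ∑ n ∈ Finset.Ico ℓ D, Real.log (1 / g n) := by
          rw [one_div, Real.log_inv, hP, Real.log_prod (fun n hn => (hgpos n hn).ne'),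
            ← Finset.sum_neg_distrib]
          refine Finset.sum_congr rfl fun n _ => ?_
          rw [one_div, Real.log_inv]
        rw [e]
        calc ∑ n ∈ Finset.Ico ℓ D, Real.log (1 / g n)
            ≤ ∑ n ∈ Finset.Ico ℓ D, (A + B * ((n : ℝ) + 1) ^ (-(1 + 1 / (m : ℝ)))) := by
              refine Finset.sum_le_sum fun n hn => ?_
              have hnD : n < D := (Finset.mem_Ico.mp hn).2
              have hℓn : ℓ ≤ n := (Finset.mem_Ico.mp hn).1
              have hb := hbound ⟨n, hnD⟩ hℓn (by simpa [hg, hnD] using hgpos n hn)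
              simpa [hg, hnD] using hb
          _ = (Finset.Ico ℓ D).card * A +
                B * ∑ n ∈ Finset.Ico ℓ D, ((n : ℝ) + 1) ^ (-(1 + 1 / (m : ℝ))) := by
              rw [Finset.sum_add_distrib, Finset.sum_const, Finset.mul_sum, nsmul_eq_mul]
          _ ≤ D * A + B * (m / (ℓ : ℝ) ^ (1 / (m : ℝ))) := by
              have hcard : ((Finset.Ico ℓ D).card : ℝ) ≤ D := by
                rw [Nat.card_Ico]; exact_mod_cast Nat.sub_le D ℓ
              exact add_le_add (mul_le_mul_of_nonneg_right hcard hA)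
                (mul_le_mul_of_nonneg_left (sharp_sum_Ico_rpow_le hm hℓ D) hB)
      have hPinv : 1 / P ≤ Real.exp X := by
        rw [← Real.exp_log (show 0 < 1 / P by positivity), Real.exp_le_exp, hX]
        have : 0 ≤ (ℓ : ℝ) * Real.log 2 := by positivity
        linarith
      calc ρ₀ ^ ℓ ≤ ∏ n ∈ Finset.range ℓ, g n := h1
        _ = (∏ n ∈ Finset.range ℓ, g n) * P * (1 / P) := by
            rw [mul_one_div, mul_div_cancel_right₀ _ hP0.ne']
        _ = (∏ i, ρ i) * (1 / P) := by rw [hsplit, hprod]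
        _ ≤ (∏ i, ρ i) * Real.exp X := mul_le_mul_of_nonneg_left hPinv hprod0

/-- Bookkeeping of the final exponent (pure real arithmetic): the collected terms
`c deg 𝔭 + ℓ log 2 + deg 𝔭 · A + B m/ℓ^{1/m}` are dominated by
`C δ h/ℓ^{1/m} + C' deg 𝔭 ((δ+1)(log(2+‖ω‖)+1) + log(deg 𝔭+1))`. [folklore] -/
theorem sharp_exponent_le {C c₀ cd m δ h D L Θ ℓ ν LD : ℝ} (hC : 0 < C) (hc₀ : 0 < c₀) (hcd : 0 < cd)
    (hm : 1 ≤ m) (hδ : 0 ≤ δ) (hD : 1 ≤ D) (hL : Real.log 2 ≤ L) (hΘ1 : 1 ≤ Θ)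
    (hΘ : Real.log Θ ≤ L) (hℓ : 1 ≤ ℓ) (hν : 1 ≤ ν) (hLD : 0 ≤ LD) :
    cd * D + (ℓ * Real.log 2 +
      D * (Real.log (2 * Θ ^ 2) + 2 * C / c₀ * (δ * L + Real.log (δ + 2))) +
      2 * C / c₀ * (δ * (h + cd * D) + D * LD) * (m / ν)) ≤
    2 * C * m / c₀ * δ * h / ν +
      (ℓ * Real.log 2 + cd + 3 + 2 * C / c₀ * (1 + m * cd + m)) * D *
        ((δ + 1) * (L + 1) + LD) := by
  have hlog2 : 0 < Real.log 2 := Real.log_pos one_lt_two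
  have hlog2' : Real.log 2 ≤ 1 := by
    have := Real.log_le_sub_one_of_pos two_pos; linarith
  have p7 : 2 * C / c₀ * (δ * h) * (m / ν) = 2 * C * m / c₀ * δ * h / ν := by
    field_simp
  set κ : ℝ := 2 * C / c₀ with hκ
  have hκ0 : 0 < κ := by positivity
  set Q : ℝ := (δ + 1) * (L + 1) with hQ
  have hL0 : 0 < L := hlog2.trans_le hL
  have hQ1 : 1 ≤ Q := by rw [hQ]; nlinarith
  have hQL : L + 1 ≤ Q := by rw [hQ]; nlinarith
  have hQδ : δ * L + δ + 1 ≤ Q := by rw [hQ]; nlinarith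
  have hQδ' : δ ≤ Q := by nlinarith
  have hΘ0 : 0 < Θ := by linarith
  have hlogΘ : Real.log (2 * Θ ^ 2) ≤ Real.log 2 + 2 * L := by
    rw [Real.log_mul two_ne_zero (by positivity), Real.log_pow]; push_cast; linarith
  have hlogδ : Real.log (δ + 2) ≤ δ + 1 := by
    have := Real.log_le_sub_one_of_pos (show 0 < δ + 2 by linarith); linarith
  have hlogδ0 : 0 ≤ Real.log (δ + 2) := Real.log_nonneg (by linarith)
  have hν0 : 0 < ν := by linarith
  have hD0 : 0 ≤ D := by linarith
  have hmν1 : m / ν ≤ m := div_le_self (by linarith) hν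
  have hmν0 : 0 ≤ m / ν := by positivity
  have hDQ : 1 ≤ D * Q := by nlinarith
  -- the pieces
  have p1 : ℓ * Real.log 2 ≤ ℓ * Real.log 2 * (D * Q) :=
    le_mul_of_one_le_right (by positivity) hDQ
  have p2 : cd * D ≤ cd * D * Q := le_mul_of_one_le_right (by positivity) hQ1
  have p3 : D * Real.log (2 * Θ ^ 2) ≤ 3 * D * Q := by
    have h3 : Real.log (2 * Θ ^ 2) ≤ 3 * Q := by linarith
    have := mul_le_mul_of_nonneg_left h3 hD0
    linarith
  have p4 : D * (κ * (δ * L + Real.log (δ + 2))) ≤ κ * D * Q := by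
    have h4 : δ * L + Real.log (δ + 2) ≤ Q := by linarith
    have := mul_le_mul_of_nonneg_left h4 (show 0 ≤ κ * D by positivity)
    linarith
  have p5 : κ * (δ * (cd * D)) * (m / ν) ≤ κ * m * cd * D * Q := by
    have h5 : δ * (m / ν) ≤ Q * m :=
      mul_le_mul hQδ' hmν1 hmν0 (by linarith)
    have := mul_le_mul_of_nonneg_left h5 (show 0 ≤ κ * cd * D by positivity)
    linarith
  have p6 : κ * (D * LD) * (m / ν) ≤ κ * m * D * LD := by
    have := mul_le_mul_of_nonneg_left hmν1 (show 0 ≤ κ * D * LD by positivity)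
    linarith
  have hR : (ℓ * Real.log 2 + cd + 3 + κ * (1 + m * cd + m)) * D * (Q + LD)
      = ℓ * Real.log 2 * (D * Q) + cd * D * Q + 3 * D * Q + κ * D * Q + κ * m * cd * D * Q
        + κ * m * D * LD
        + (κ * m * D * Q + (ℓ * Real.log 2 + cd + 3 + κ * (1 + m * cd)) * D * LD) := by ring
  have hextra : 0 ≤ κ * m * D * Q + (ℓ * Real.log 2 + cd + 3 + κ * (1 + m * cd)) * D * LD := by
    positivity
  have hLHS : cd * D + (ℓ * Real.log 2 + D * (Real.log (2 * Θ ^ 2) + κ * (δ * L + Real.log (δ + 2))) +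
      κ * (δ * (h + cd * D) + D * LD) * (m / ν))
      = cd * D + ℓ * Real.log 2 + D * Real.log (2 * Θ ^ 2) + D * (κ * (δ * L + Real.log (δ + 2)))
        + κ * (δ * h) * (m / ν) + κ * (δ * (cd * D)) * (m / ν) + κ * (D * LD) * (m / ν) := by
    ring
  rw [hLHS, hR, ← p7]
  linarith [p1, p2, p3, p4, p5, p6, hextra]

/-! ### The registered sub-goal of this helper file -/

/-- **Registered sub-goal `stub_sharpClosestPoint_lemmas`** (crux `stmt-Schanuel-6117`, line
`orbit-interpolation-determinant`; the part of stub `stub_sharpClosestPoint` carried by this helper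
file): the projective distance is at most `2`, and the tail sum `Σ_{k ∈ [ℓ, N)} (k+1)^{-(1+1/m)} ≤ m/ℓ^{1/m}`.
[folklore] -/
theorem stub_sharpClosestPoint_lemmas :
    (∀ (m : ℕ) (φ ψ : Fin (m + 1) → ℂ), projDist φ ψ ≤ 2) ∧
    (∀ (m ℓ N : ℕ), 1 ≤ m → 1 ≤ ℓ → ∑ k ∈ Finset.Ico ℓ N, ((k : ℝ) + 1) ^ (-(1 + 1 / (m : ℝ))) ≤ m / (ℓ : ℝ) ^ (1 / (m : ℝ))) :=
  ⟨fun _ φ ψ => Literature.NumberTheory.Transcendental.NguyenRoy.projDist_le_two φ ψ,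
    fun _ _ N hm hℓ => sharp_sum_Ico_rpow_le hm hℓ N⟩

end Summit.Schanuel.Schanuel.Cruxes.ApproximationProperty.OrbitInterpolationDeterminant

end
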